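/-
Copyright (c) 2026. All rights reserved.
Released under Apache 2.0 license as described in the file LICENSE.
-/
import Literature.NumberTheory.ComplexMultiplication.CMTypeRank
import HarnessLib

/-!
# White 1993, §4–§5: sporadic subsets ⟷ odd `{0, ±1}`-annihilators («right annihilators of `S − cS` with coefficients
# `0, ±1`»), annihilators with coefficients `≤ n` ⟷ asymmetric balanced multiplicities (the powers `Aⁿ`), and
# LEMMA 2 (rank maximal ⟺ no odd annihilator) — at the level of a group acting on the embeddings

Companion of `CMTypeRank.lean` (same abstract setting: a group `G` acting on a finite set `E` of «embeddings», a CM type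
`Φ ⊆ E` for a «complex conjugation» `ρ ∈ G`, `IsCMTypeWith ρ Φ`; in print `E = Hom(K, ℂ)`, `G = Aut(ℂ)` or
`Gal(Kᶜ/ℚ)`).  The file `DegenerateCMTypesAbelianSporadicSubsets` proved these dictionary entries for a finite ABELIAN
group acting on itself (White's Prop. 1 (2) ⟺ (3) «for any finite `G` with central `ρ`» in the regular indexing); here
they are proved for an ARBITRARY action, which is what the tree's carriers `Hom(K, ℂ)` (any CM field `K`, Galois or
not) consume — see `AlgebraicGeometry/Pohlmann1968/WhiteSporadicCriterion` for the abelian-variety dress.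
THEOREMS ONLY (no definition, no named fact, no `sorry`).

## The print

S. P. White, *Sporadic cycles on CM abelian varieties*, Compositio Math. **88** (1993) 123–142
[White1993SporadicCycles], §4 (p. 130): «the two conditions for a sporadic `Δ` can be reinterpreted in the ring `ℚ[G]⁻`
as [`(S − cS)·(Δ⁻¹ − cΔ⁻¹) = 0`] … Any element of `ℚ[G]⁻` whose coefficients are all `±1` can be put in the form
`S − cS`. Similarly, any element whose coefficients are `0, ±1` can put in the form `Δ⁻¹ − cΔ⁻¹`. If the product of the
two is zero then the elements correspond to a CM-type for which there exists a sporadic cycle. … However, if we consider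
higher powers `Aⁿ` of `A`, a sporadic cycle on `Aⁿ` would correspond to a right annihilator of `S − cS` in `ℚ[G]⁻` whose
coefficients are `0, ±1, …, ±n`. Thus if `S − cS` is not a `G`-module generator of `ℚ[G]⁻` or equivalently has a right
annihilator then there exists a high enough power `Aⁿ` such that `Aⁿ` has a sporadic cycle.»  **LEMMA 2** (p. 130):
«Let `(K, S)` be a Galois CM-type with Galois group `G` and central involution `c`. The rank of the corresponding
Mumford–Tate group is maximal if and only if `S − cS` is a `G`-module generator of `ℚ[G]⁻`.»  **PROPOSITION 1**
(p. 132), (2) ⟺ (3): «2. There exists a sporadic `Δ`. 3. There exists (nonzero) `β ∈ ℚ[G₀]` whose coefficients are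
`±1` or `0` such that `α·β = 0`.»

## Dictionary (module docstring of `DegenerateCMTypesAbelianSporadicSubsets`, now for any action)

An element of `ℚ[G]⁻` ↔ an ODD weight `β : E → ℚ` (`β(ρx) = −β(x)`); «right annihilator of `S − cS`» ↔ `β`
annihilates every translate of `Φ`: `Σ_x β(x)[gx ∈ Φ] = 0` for all `g` (for odd `β`, `Σ_x β(x)(𝟙_{g⁻¹Φ} − 𝟙_{g⁻¹Φ̄})(x)
= 2 Σ_x β(x)[gx ∈ Φ]`, tree `WhiteLenstra.sum_mul_antiVec_eq_two_mul`); «coefficients `0, ±1`» ↔ `β(x) ∈ {0, ±1}`;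
«`Δ⁻¹ − cΔ⁻¹`» ↔ `𝟙_Δ − 𝟙_{ρΔ}`; a sporadic `Δ` ↔ a finite `Δ ⊆ E` with `𝟙_Δ` balanced (Pohlmann's condition,
`IsBalanced`) and some `x ∈ Δ` with `ρx ∉ Δ`; «coefficients `0, ±1, …, ±n`» ↔ an odd INTEGER annihilator, which is
the antisymmetric part `f − f∘ρ` of a balanced multiplicity function `f : E → ℕ` (a weight of the power `Aⁿ`, `n ≥ max f`).

## What is proved (`h : IsCMTypeWith ρ Φ`, `E` finite)

* §1 `isBalanced_of_oddAnnihilator` (an odd annihilator is a balanced weight of mass `0`).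
* §2 (3) ⟹ (2): `isBalanced_indicator_posPart`, **`exists_sporadicSet_of_oddAnnihilator`** («this can be rewritten in
  the form `Δ⁻¹ − cΔ⁻¹`»: `Δ = {β = 1}`).
* §3 (2) ⟹ (3): **`exists_oddAnnihilator_of_sporadicSet`** (`β = 𝟙_Δ − 𝟙_Δ∘ρ`), and
  **`exists_sporadicSet_iff_exists_oddAnnihilator`** (PROP. 1 (2) ⟺ (3), any action).
* §4 the powers: **`exists_intOddAnnihilator_of_isBalanced_nat`** (a balanced `ℕ`-weight with an asymmetric
  multiplicity gives a nonzero odd integer annihilator bounded by the multiplicities) and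
  **`isBalanced_posPart_of_intOddAnnihilator`** / `posPart_sub_posPart_rho_eq` (an odd integer annihilator `β` is
  `f − f∘ρ` for the balanced `ℕ`-weight `f = β⁺`, `max f = max |β|`).
* §5 **LEMMA 2**: `typeRank_eq_iff_forall_oddAnnihilator_eq_zero` — `rank(Φ) = |E|/2 + 1` iff every odd rational
  annihilator of the translates of `Φ` vanishes; `typeRank_ne_iff_exists_intOddAnnihilator` (degenerate iff a nonzero
  odd INTEGER annihilator exists — «then there exists a high enough power `Aⁿ` such that `Aⁿ` has a sporadic cycle»).

## References
* [White1993SporadicCycles] S. P. White, Compositio Math. 88 (1993) 123–142 — §4 (p. 130), Lemma 2, Thm. 3 (proof),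
  §5 Prop. 1.
* [Gordon1999HodgeAVSurvey] B. B. Gordon (1999) — §9.2 (9.2.1), 9.2.2, §9.3.
* [Kubota1965] T. Kubota, Trans. AMS 118 (1965) — §2 (rank, nondegenerate).
* [Shimura1998] G. Shimura (1998) — §32.10 (`r(φ − φρ) = r(φ) − 1`).

## Provenance
Cell `pub-hodgecm2` (COR-CM), literature seat `lit-deligne-3` gen 20 (claim PROP1-GENERAL; count-neutral); consumes BY NAME
`IsCMTypeWith.isBalanced_of_symm`, `isBalanced_comp_rho`, `IsBalanced.sub`, `symm_of_isBalanced_of_typeRank_eq`,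
`typeRank_eq_of_forall_nat_symm` (`CMTypeRank.lean`).
-/

set_option autoImplicit false

open scoped BigOperators

namespace Literature.NumberTheory.ComplexMultiplication

namespace IsCMTypeWith

variable {G : Type*} [Group G] {E : Type*} [MulAction G E] [Fintype E] {ρ : G} {Φ : Set E}
variable (h : IsCMTypeWith ρ Φ)
include h

/-! ## §1 Odd weights and annihilators -/

omit [Fintype E] in
/-- `x ↦ ρx` is a bijection of `E`. [folklore] -/
private theorem rho_smul_bijective' : Function.Bijective fun x : E => ρ • x :=
  ⟨fun x y hxy => by simpa [h.invol] using congrArg (fun z => ρ • z) hxy, fun y => ⟨ρ • y, h.invol y⟩⟩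

/-- An ODD weight (`β(ρx) = −β(x)`, an element of `ℚ[G]⁻`) has total mass `0`. [cite: White1993SporadicCycles, §4 (p. 130)] -/
theorem sum_eq_zero_of_odd {β : E → ℚ} (hodd : ∀ x, β (ρ • x) = -β x) : ∑ x, β x = 0 := by
  have h1 : ∑ x, β (ρ • x) = ∑ x, β x := Function.Bijective.sum_comp h.rho_smul_bijective' β
  simp only [hodd, Finset.sum_neg_distrib] at h1
  linarith

/-- **An odd annihilator of the translates of `Φ` is a balanced weight** (both sides of Pohlmann's condition vanish).
[cite: White1993SporadicCycles, §4 (p. 130)] [cite: Gordon1999HodgeAVSurvey, §9.2 (9.2.1)] -/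
theorem isBalanced_of_oddAnnihilator {β : E → ℚ} (hodd : ∀ x, β (ρ • x) = -β x)
    (hann : ∀ g : G, ∑ x, β x * translateInd Φ g x = 0) : IsBalanced G Φ β := by
  intro g
  rw [hann g, h.sum_eq_zero_of_odd hodd, mul_zero]

/-! ## §2 From an odd `{0, ±1}`-annihilator to a sporadic subset: `Δ = {β = 1}` -/

/-- **«This can be rewritten in the form `Δ⁻¹ − cΔ⁻¹`.»**  If `β : E → ℚ` takes the values `0, ±1`, is odd and
annihilates every translate of `Φ`, then `Δ = {β = 1}` satisfies Pohlmann's condition: `𝟙_Δ = (β + β²)/2` with `β`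
balanced of mass `0` and `β²` `ρ`-invariant. [cite: White1993SporadicCycles, §4 Theorem 3 (proof) and §5 Prop. 1] -/
theorem isBalanced_indicator_posPart {β : E → ℚ} (hval : ∀ x, β x = 0 ∨ β x = 1 ∨ β x = -1)
    (hodd : ∀ x, β (ρ • x) = -β x) (hann : ∀ g : G, ∑ x, β x * translateInd Φ g x = 0) :
    IsBalanced G Φ (fun x => if β x = 1 then (1 : ℚ) else 0) := by
  have hind : ∀ x, (if β x = 1 then (1 : ℚ) else 0) = (β x + β x ^ 2) / 2 := by
    intro x
    rcases hval x with hx | hx | hx <;> rw [hx] <;> norm_num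
  have hsq : IsBalanced G Φ (fun x => β x ^ 2) :=
    h.isBalanced_of_symm (f := fun x => β x ^ 2) fun x => by simp only [hodd x, neg_sq]
  have hsum : ∑ x, β x = 0 := h.sum_eq_zero_of_odd hodd
  intro g
  simp_rw [hind]
  have h1 : (2 : ℚ) * ∑ x, (β x + β x ^ 2) / 2 * translateInd Φ g x =
      ∑ x, β x * translateInd Φ g x + ∑ x, β x ^ 2 * translateInd Φ g x := by
    rw [Finset.mul_sum, ← Finset.sum_add_distrib]
    exact Finset.sum_congr rfl fun x _ => by ring
  have h2 : ∑ x, (β x + β x ^ 2) / 2 = (∑ x, β x) / 2 + (∑ x, β x ^ 2) / 2 := by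
    rw [Finset.sum_div, Finset.sum_div, ← Finset.sum_add_distrib]
    exact Finset.sum_congr rfl fun x _ => by ring
  rw [h1, h2, hann g, hsum, zero_add, zero_div, zero_add]
  have h3 := hsq g
  linarith

/-- **PROP. 1, (3) ⟹ (2), for any action: an odd nonzero `{0, ±1}`-annihilator yields a SPORADIC subset** — a finite
`Δ ⊆ E` with `𝟙_Δ` balanced, non-empty, and `Δ ∩ ρΔ = ∅`. [cite: White1993SporadicCycles, §5 Prop. 1 ((3) ⟹ (2)) and §4 Theorem 3 (proof)] -/
theorem exists_sporadicSet_of_oddAnnihilator [DecidableEq E] {β : E → ℚ}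
    (hval : ∀ x, β x = 0 ∨ β x = 1 ∨ β x = -1) (hne : β ≠ 0) (hodd : ∀ x, β (ρ • x) = -β x)
    (hann : ∀ g : G, ∑ x, β x * translateInd Φ g x = 0) :
    ∃ Δ : Finset E, IsBalanced G Φ (fun x => if x ∈ Δ then (1 : ℚ) else 0) ∧ Δ.Nonempty ∧
      ∀ x ∈ Δ, ρ • x ∉ Δ := by
  refine ⟨Finset.univ.filter fun x => β x = 1, ?_, ?_, ?_⟩
  · have hb := h.isBalanced_indicator_posPart hval hodd hann
    intro g
    simp only [Finset.mem_filter, Finset.mem_univ, true_and]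
    exact hb g
  · -- some `x` has `β x = ±1`; then `x` or `ρx` lies in `Δ`
    obtain ⟨x, hx⟩ : ∃ x, β x ≠ 0 := by
      by_contra hall
      push Not at hall
      exact hne (funext hall)
    rcases hval x with h0 | h1 | hm1
    · exact absurd h0 hx
    · exact ⟨x, Finset.mem_filter.2 ⟨Finset.mem_univ _, h1⟩⟩
    · refine ⟨ρ • x, Finset.mem_filter.2 ⟨Finset.mem_univ _, ?_⟩⟩
      rw [hodd, hm1, neg_neg]
  · intro x hx hρx
    rw [Finset.mem_filter] at hx hρx
    have h1 := hρx.2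
    rw [hodd, hx.2] at h1
    norm_num at h1

/-! ## §3 From a sporadic subset to an odd `{0, ±1}`-annihilator: `β = 𝟙_Δ − 𝟙_{ρΔ}` -/

/-- **PROP. 1, (2) ⟹ (3), for any action**: if `Δ ⊆ E` has balanced indicator and `x ∈ Δ`, `ρx ∉ Δ`, then
`β = 𝟙_Δ − 𝟙_Δ ∘ ρ` (White's `Δ⁻¹ − cΔ⁻¹`) takes the values `0, ±1`, is non-zero (`β(x) = 1`), odd, and annihilates
every translate of `Φ` (`𝟙_Δ` and `𝟙_Δ ∘ ρ` are balanced of the same mass). [cite: White1993SporadicCycles, §5 Prop. 1 ((2) ⟹ (3)) and §4 (p. 130)] -/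
theorem exists_oddAnnihilator_of_sporadicSet [DecidableEq E] {Δ : Finset E}
    (hbal : IsBalanced G Φ (fun x => if x ∈ Δ then (1 : ℚ) else 0)) {x : E} (hx : x ∈ Δ) (hx' : ρ • x ∉ Δ) :
    ∃ β : E → ℚ, (∀ y, β y = 0 ∨ β y = 1 ∨ β y = -1) ∧ β ≠ 0 ∧ (∀ y, β (ρ • y) = -β y) ∧
      ∀ g : G, ∑ y, β y * translateInd Φ g y = 0 := by
  set ind : E → ℚ := fun y => if y ∈ Δ then (1 : ℚ) else 0 with hind
  refine ⟨fun y => ind y - ind (ρ • y), ?_, ?_, ?_, ?_⟩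
  · intro y
    simp only [hind]
    by_cases h1 : y ∈ Δ <;> by_cases h2 : ρ • y ∈ Δ <;> simp [h1, h2]
  · intro hzero
    have := congrFun hzero x
    simp only [hind, if_pos hx, if_neg hx', Pi.zero_apply] at this
    norm_num at this
  · intro y
    simp only [hind, h.invol]
    ring
  · intro g
    have hρ := h.isBalanced_comp_rho hbal
    have e1 := hbal g
    have e2 := hρ g
    -- the two balanced weights have the same mass
    have hmass : ∑ y, ind (ρ • y) = ∑ y, ind y := Function.Bijective.sum_comp h.rho_smul_bijective' ind
    simp only [sub_mul, Finset.sum_sub_distrib]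
    simp only [hind] at e1 e2 hmass ⊢
    linarith

/-- **PROPOSITION 1, (2) ⟺ (3), for an arbitrary action** («2. There exists a sporadic `Δ`. 3. There exists (nonzero)
`β` … whose coefficients are `±1` or `0` such that `α·β = 0`»). [cite: White1993SporadicCycles, §5 Prop. 1] -/
theorem exists_sporadicSet_iff_exists_oddAnnihilator [DecidableEq E] :
    (∃ Δ : Finset E, IsBalanced G Φ (fun x => if x ∈ Δ then (1 : ℚ) else 0) ∧ ∃ x ∈ Δ, ρ • x ∉ Δ) ↔
      ∃ β : E → ℚ, (∀ y, β y = 0 ∨ β y = 1 ∨ β y = -1) ∧ β ≠ 0 ∧ (∀ y, β (ρ • y) = -β y) ∧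
        ∀ g : G, ∑ y, β y * translateInd Φ g y = 0 := by
  constructor
  · rintro ⟨Δ, hbal, x, hx, hx'⟩
    exact h.exists_oddAnnihilator_of_sporadicSet hbal hx hx'
  · rintro ⟨β, hval, hne, hodd, hann⟩
    obtain ⟨Δ, hbal, ⟨x, hx⟩, hsp⟩ := h.exists_sporadicSet_of_oddAnnihilator hval hne hodd hann
    exact ⟨Δ, hbal, x, hx, hsp x hx⟩

/-! ## §4 Coefficients `0, ±1, …, ±n`: asymmetric balanced multiplicities (the powers `Aⁿ`) -/

/-- **A balanced `ℕ`-weight with an ASYMMETRIC multiplicity gives a nonzero odd INTEGER annihilator**, `β = f − f∘ρ`,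
with `|β| ≤ max(f, f∘ρ)` pointwise («a sporadic cycle on `Aⁿ` would correspond to a right annihilator of `S − cS` in
`ℚ[G]⁻` whose coefficients are `0, ±1, …, ±n`»). [cite: White1993SporadicCycles, §4 (p. 130)] -/
theorem exists_intOddAnnihilator_of_isBalanced_nat {f : E → ℕ} (hbal : IsBalanced G Φ (fun x => (f x : ℚ)))
    {x : E} (hx : f (ρ • x) ≠ f x) :
    ∃ β : E → ℤ, β ≠ 0 ∧ (∀ y, β (ρ • y) = -β y) ∧ (∀ g : G, ∑ y, (β y : ℚ) * translateInd Φ g y = 0) ∧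
      ∀ y, (β y).natAbs ≤ max (f y) (f (ρ • y)) := by
  refine ⟨fun y => (f y : ℤ) - (f (ρ • y) : ℤ), ?_, ?_, ?_, ?_⟩
  · intro hzero
    have := congrFun hzero x
    simp only [Pi.zero_apply] at this
    exact hx (by exact_mod_cast (sub_eq_zero.1 this).symm)
  · intro y
    simp only [h.invol]
    ring
  · intro g
    have hρ := h.isBalanced_comp_rho hbal
    have e1 := hbal g
    have e2 := hρ g
    have hmass : ∑ y, ((f (ρ • y) : ℕ) : ℚ) = ∑ y, (f y : ℚ) :=
      Function.Bijective.sum_comp h.rho_smul_bijective' (fun y => (f y : ℚ))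
    push_cast
    simp only [sub_mul, Finset.sum_sub_distrib]
    linarith
  · intro y
    dsimp only
    omega

omit [Fintype E] h in
/-- For an odd integer weight, the positive parts of `β(y)` and `β(ρy) = −β(y)` differ by `β(y)`:
`β⁺(y) − β⁺(ρy) = β(y)`. [cite: White1993SporadicCycles, §4 (p. 130)] -/
theorem posPart_sub_posPart_rho_eq {β : E → ℤ} (hodd : ∀ y, β (ρ • y) = -β y) (y : E) :
    ((β y).toNat : ℤ) - ((β (ρ • y)).toNat : ℤ) = β y := by
  rw [hodd, Int.toNat_sub_toNat_neg]

/-- **An odd INTEGER annihilator is the antisymmetric part of a balanced `ℕ`-weight**: for `β : E → ℤ` odd and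
annihilating the translates of `Φ`, the positive part `f = β⁺` is a BALANCED `ℕ`-valued weight (`2β⁺ = β + |β|`, `|β|`
is `ρ`-invariant, `β` is balanced of mass `0`) with `f − f∘ρ = β` (`posPart_sub_posPart_rho_eq`) — the multiplicity
function of a weight of the power `Aⁿ`, `n = max |β|` («any element whose coefficients are `0, ±1, …` can be put in the
form `Δ⁻¹ − cΔ⁻¹`» for a multiset `Δ`). [cite: White1993SporadicCycles, §4 (p. 130)] -/
theorem isBalanced_posPart_of_intOddAnnihilator {β : E → ℤ} (hodd : ∀ y, β (ρ • y) = -β y)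
    (hann : ∀ g : G, ∑ y, (β y : ℚ) * translateInd Φ g y = 0) :
    IsBalanced G Φ (fun y => ((β y).toNat : ℚ)) := by
  -- `β⁺ − β⁺∘ρ = β` (odd annihilator, balanced of mass `0`) and `β⁺ + β⁺∘ρ` is `ρ`-invariant (balanced)
  have hD : ∀ y, ((β y).toNat : ℚ) - ((β (ρ • y)).toNat : ℚ) = (β y : ℚ) := fun y => by
    exact_mod_cast posPart_sub_posPart_rho_eq (E := E) hodd y
  have hS : IsBalanced G Φ (fun y => ((β y).toNat : ℚ) + ((β (ρ • y)).toNat : ℚ)) :=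
    h.isBalanced_of_symm (f := fun y => ((β y).toNat : ℚ) + ((β (ρ • y)).toNat : ℚ)) fun y => by
      simp only [h.invol]; ring
  have hoddQ : ∀ y, (β (ρ • y) : ℚ) = -(β y : ℚ) := fun y => by exact_mod_cast hodd y
  have hβ : IsBalanced G Φ (fun y => (β y : ℚ)) := h.isBalanced_of_oddAnnihilator hoddQ hann
  intro g
  have e1 := hS g
  have e2 := hβ g
  simp only [← hD] at e2
  simp only [add_mul, sub_mul, Finset.sum_add_distrib, Finset.sum_sub_distrib] at e1 e2
  linarith

omit [Fintype E] h in
/-- With `f = β⁺` as above, `f` has an asymmetric multiplicity as soon as `β ≠ 0`. [cite: White1993SporadicCycles, §4 (p. 130)] -/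
theorem exists_posPart_rho_ne_of_ne_zero {β : E → ℤ} (hodd : ∀ y, β (ρ • y) = -β y) (hne : β ≠ 0) :
    ∃ y, (β (ρ • y)).toNat ≠ (β y).toNat := by
  obtain ⟨y, hy⟩ : ∃ y, β y ≠ 0 := by
    by_contra hall
    push Not at hall
    exact hne (funext hall)
  refine ⟨y, fun heq => hy ?_⟩
  have := posPart_sub_posPart_rho_eq (E := E) hodd y
  rw [heq, sub_self] at this
  exact this.symm

/-! ## §5 LEMMA 2: the rank is maximal iff no odd annihilator exists -/

/-- **LEMMA 2** («The rank of the corresponding Mumford–Tate group is maximal if and only if `S − cS` is a `G`-module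
generator of `ℚ[G]⁻`», i.e. iff `S − cS` has no nonzero right annihilator in `ℚ[G]⁻`): `rank(Φ) = |E|/2 + 1` iff every
odd rational weight annihilating all translates of `Φ` is zero.  ⟹: a nondegenerate type has all balanced weights
`ρ`-invariant (tree `symm_of_isBalanced_of_typeRank_eq`), and an odd `ρ`-invariant weight vanishes; ⟸: a degenerate type
has a balanced `ℕ`-weight with an asymmetric multiplicity (tree `typeRank_eq_of_forall_nat_symm`), whose antisymmetric
part is a nonzero odd annihilator. [cite: White1993SporadicCycles, §4 Lemma 2] [cite: Kubota1965, §2] [cite: Shimura1998, §32.10] -/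
theorem typeRank_eq_iff_forall_oddAnnihilator_eq_zero [Nonempty E] :
    typeRank G Φ = Fintype.card E / 2 + 1 ↔
      ∀ β : E → ℚ, (∀ y, β (ρ • y) = -β y) → (∀ g : G, ∑ y, β y * translateInd Φ g y = 0) → β = 0 := by
  constructor
  · intro hrank β hodd hann
    funext y
    have hsym := h.symm_of_isBalanced_of_typeRank_eq hrank (h.isBalanced_of_oddAnnihilator hodd hann) y
    rw [hodd] at hsym
    have : β y = 0 := by linarith
    simpa using this
  · intro H
    refine h.typeRank_eq_of_forall_nat_symm fun f hf x => ?_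
    by_contra hx
    obtain ⟨β, hne, hodd, hann, -⟩ := h.exists_intOddAnnihilator_of_isBalanced_nat hf (x := x) hx
    have hzero := H (fun y => (β y : ℚ)) (fun y => by exact_mod_cast hodd y) hann
    exact hne (funext fun y => by
      have e := congrFun hzero y
      simp only [Pi.zero_apply, Int.cast_eq_zero] at e
      simpa using e)

/-- **Degenerate ⟺ a nonzero odd INTEGER annihilator exists** («if `S − cS` … has a right annihilator then there exists
a high enough power `Aⁿ` such that `Aⁿ` has a sporadic cycle», with LEMMA 2). [cite: White1993SporadicCycles, §4 (p. 130) and Lemma 2] -/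
theorem typeRank_ne_iff_exists_intOddAnnihilator [Nonempty E] :
    typeRank G Φ ≠ Fintype.card E / 2 + 1 ↔
      ∃ β : E → ℤ, β ≠ 0 ∧ (∀ y, β (ρ • y) = -β y) ∧ ∀ g : G, ∑ y, (β y : ℚ) * translateInd Φ g y = 0 := by
  rw [ne_eq, h.typeRank_eq_iff_forall_oddAnnihilator_eq_zero]
  constructor
  · intro H
    by_contra hnone
    apply H
    intro β hodd hann
    -- clear denominators: an odd rational annihilator with a common denominator is an integer one
    by_contra hβ
    obtain ⟨d, hd, hint⟩ : ∃ d : ℕ, 0 < d ∧ ∀ y, ∃ z : ℤ, (d : ℚ) * β y = z := by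
      refine ⟨∏ y, (β y).den, Finset.prod_pos fun y _ => (β y).den_pos, fun y => ?_⟩
      obtain ⟨c, hc⟩ : (β y).den ∣ ∏ z, (β z).den :=
        Finset.dvd_prod_of_mem (fun z => (β z).den) (Finset.mem_univ y)
      refine ⟨(β y).num * c, ?_⟩
      rw [hc]
      push_cast
      have hnum : (β y) * (β y).den = (β y).num := Rat.mul_den_eq_num (β y)
      calc ((β y).den : ℚ) * (c : ℚ) * β y = (β y * (β y).den) * c := by ring
        _ = (β y).num * c := by rw [hnum]
    choose z hz using hint
    refine hnone ⟨z, ?_, ?_, ?_⟩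
    · intro hz0
      apply hβ
      funext y
      have := hz y
      rw [congrFun hz0 y] at this
      simp only [Pi.zero_apply, Int.cast_zero, mul_eq_zero, Nat.cast_eq_zero] at this
      rcases this with h0 | h0
      · exact absurd h0 hd.ne'
      · simpa using h0
    · intro y
      have e1 := hz (ρ • y)
      have e2 := hz y
      rw [hodd] at e1
      have : (z (ρ • y) : ℚ) = -(z y : ℚ) := by rw [← e1, ← e2]; ring
      exact_mod_cast this
    · intro g
      have := hann g
      calc ∑ y, (z y : ℚ) * translateInd Φ g y = ∑ y, (d : ℚ) * (β y * translateInd Φ g y) :=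
            Finset.sum_congr rfl fun y _ => by rw [← hz y]; ring
        _ = 0 := by rw [← Finset.mul_sum, this, mul_zero]
  · rintro ⟨β, hne, hodd, hann⟩ H
    have hzero := H (fun y => (β y : ℚ)) (fun y => by exact_mod_cast hodd y) hann
    exact hne (funext fun y => by
      have e := congrFun hzero y
      simp only [Pi.zero_apply, Int.cast_eq_zero] at e
      simpa using e)

end IsCMTypeWith

end Literature.NumberTheory.ComplexMultiplication
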